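import Summits.Ventures.PercRepro.S2ContractionCount
import Summits.Ventures.PercRepro.S2PaymentTop

/-!
# PercRepro — S2: THE COMPLEMENT LEVER FOR THE TOP `7`-SETS AT CORANK `7` (p7, gen 17; sub-claim S2; the concentrated case
`ν = d − 2` of the row `p = 13`)

A top `7`-set `B` at corank `7` (`ρ(B) = 5`, `E ∖ B` spanning) has `E ∖ B` a BASIS, so for any flat `W` the part `W ∖ B` is
independent; and if `B` meets `W` in `5` points that trace `T = B ∩ W` is DEPENDENT (an independent trace of `5` points would have
the rank of `B`, so `B ⊆ cl T ⊆ cl W = W`, against `|B ∖ W| = 2`). Hence, when every top `7`-set meets `W` in `≥ 5` points: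
**`ncard_top_seven_le_of_compl_indep`** —
  `#{top 7-sets} ≤ #{T ⊆ W : |T| = 5, T dependent, W ∖ T independent} · C(|E ∖ W|, 2) + C(|W|, 6)·|E ∖ W| + C(|W|, 7)`.
On a `10`-point `W` the map `T ↦ W ∖ T` swaps that family with the disjoint family `{T : |T| = 5, T independent, W ∖ T dependent}`,
so it has at most `C(10, 5)/2 = 126` members (**`ncard_dep_compl_indep_five_le`**) — against the kit's hitting count
`C(10, 5)·C(10, 2) = 11340` for the trace class `j = 5`. Axioms: standard.
-/

open scoped Matroid

namespace PercRepro

namespace S2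

open Set

variable {α : Type}

/-- **The top `7`-sets through a flat `W` at corank `7` by the complement lever**: the trace of size `5` is dependent with an
independent complement in `W`. -/
theorem ncard_top_seven_le_of_compl_indep (M : Matroid α) [M.Finite] {p : ℕ} (hR : M.eRank = (p : ℕ∞))
    (hn : M.E.ncard = p + 7) {W : Set α} (hW : W ⊆ M.E) (hWcl : M.closure W = W)
    (hhit : ∀ B, B ⊆ M.E → B.ncard = 7 → M.eRk B = 5 → M.eRk (M.E \ B) = M.eRank → 5 ≤ (B ∩ W).ncard) :
    {B : Set α | B ⊆ M.E ∧ B.ncard = 7 ∧ M.eRk B = 5 ∧ M.eRk (M.E \ B) = M.eRank}.ncard ≤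
      {T : Set α | T ⊆ W ∧ T.ncard = 5 ∧ M.Dep T ∧ M.Indep (W \ T)}.ncard * (M.E \ W).ncard.choose 2 +
        W.ncard.choose 6 * (M.E \ W).ncard + W.ncard.choose 7 := by
  classical
  set Top := {B : Set α | B ⊆ M.E ∧ B.ncard = 7 ∧ M.eRk B = 5 ∧ M.eRk (M.E \ B) = M.eRank} with hTop
  have hEfin := M.ground_finite
  have hWfin : W.Finite := hEfin.subset hW
  have hRfin : (M.E \ W).Finite := hEfin.sdiff
  have hTopfin : Top.Finite := hEfin.finite_subsets.subset (fun B hB => hB.1)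
  let C : ℕ → Set (Set α) := fun j => {B ∈ Top | (B ∩ W).ncard = j}
  have hCfin : ∀ j, (C j).Finite := fun j => hTopfin.subset (fun B hB => hB.1)
  have hcover : Top ⊆ C 5 ∪ C 6 ∪ C 7 := by
    intro B hB
    obtain ⟨hBE, hB7, hB5, hBs⟩ := hB
    have hBfin : B.Finite := hEfin.subset hBE
    have hj1 : 5 ≤ (B ∩ W).ncard := hhit B hBE hB7 hB5 hBs
    have hj2 : (B ∩ W).ncard ≤ 7 := hB7 ▸ Set.ncard_le_ncard Set.inter_subset_left hBfin
    rcases (show (B ∩ W).ncard = 5 ∨ (B ∩ W).ncard = 6 ∨ (B ∩ W).ncard = 7 by omega) with h | h | h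
    · exact Or.inl (Or.inl ⟨⟨hBE, hB7, hB5, hBs⟩, h⟩)
    · exact Or.inl (Or.inr ⟨⟨hBE, hB7, hB5, hBs⟩, h⟩)
    · exact Or.inr ⟨⟨hBE, hB7, hB5, hBs⟩, h⟩
  -- the complement of a top `7`-set is a basis: `E ∖ B` is independent
  have hcompl : ∀ B ∈ Top, M.Indep (M.E \ B) := by
    rintro B ⟨hBE, hB7, -, hBs⟩
    have hBfin : B.Finite := hEfin.subset hBE
    rw [Matroid.indep_iff_eRk_eq_encard_of_finite hEfin.sdiff, hBs, hR, ← hEfin.sdiff.cast_ncard_eq,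
      Set.ncard_sdiff hBE hBfin, hn, hB7, Nat.add_sub_cancel]
  -- the class `j = 5`: the trace is dependent with an independent complement
  have hC5 : (C 5).ncard ≤ {T : Set α | T ⊆ W ∧ T.ncard = 5 ∧ M.Dep T ∧ M.Indep (W \ T)}.ncard * (M.E \ W).ncard.choose 2 := by
    rw [← ncard_subsets_ncard_eq (M.E \ W) hRfin 2, ← Set.ncard_prod]
    refine Set.ncard_le_ncard_of_injOn (fun B : Set α => (B ∩ W, B \ W)) ?_ ?_
      ((hWfin.finite_subsets.subset (fun T hT => hT.1)).prod (hRfin.finite_subsets.subset (fun X hX => hX.1)))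
    · rintro B ⟨⟨hBE, hB7, hB5, hBs⟩, hj⟩
      have hBfin : B.Finite := hEfin.subset hBE
      have hsplit := Set.ncard_inter_add_ncard_sdiff_eq_ncard B W hBfin
      refine Set.mem_prod.2 ⟨⟨Set.inter_subset_right, hj, ?_, ?_⟩, ⟨sdiff_subset_sdiff_left hBE, ?_⟩⟩
      · rw [M.dep_iff]
        refine ⟨fun hind => ?_, Set.inter_subset_left.trans hBE⟩
        have hr : M.eRk (B ∩ W) = 5 := by
          rw [hind.eRk_eq_encard, ← (hBfin.inter_of_left W).cast_ncard_eq, hj]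
          rfl
        have hcl : M.closure (B ∩ W) = M.closure B :=
          (M.isRkFinite_set (B ∩ W)).closure_eq_closure_of_subset_of_eRk_ge_eRk Set.inter_subset_left (by rw [hr, hB5])
        have hBW : B ⊆ W := by
          calc B ⊆ M.closure B := M.subset_closure B hBE
            _ = M.closure (B ∩ W) := hcl.symm
            _ ⊆ M.closure W := M.closure_subset_closure Set.inter_subset_right
            _ = W := hWcl
        rw [Set.inter_eq_left.2 hBW, hB7] at hj
        omega
      · have h := hcompl B ⟨hBE, hB7, hB5, hBs⟩
        refine h.subset ?_
        rw [Set.sdiff_inter_self_eq_sdiff]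
        exact Set.sdiff_subset_sdiff_left hW
      · show (B \ W).ncard = 2
        omega
    · rintro B₁ - B₂ - hEq
      simp only [Prod.mk.injEq] at hEq
      rw [← Set.inter_union_sdiff B₁ W, ← Set.inter_union_sdiff B₂ W, hEq.1, hEq.2]
  -- the class `j = 6`: a `6`-subset of `W` and one outside point
  have hC6 : (C 6).ncard ≤ W.ncard.choose 6 * (M.E \ W).ncard := by
    rw [← Nat.choose_one_right (M.E \ W).ncard, ← ncard_subsets_ncard_eq W hWfin 6,
      ← ncard_subsets_ncard_eq (M.E \ W) hRfin 1, ← Set.ncard_prod]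
    refine Set.ncard_le_ncard_of_injOn (fun B : Set α => (B ∩ W, B \ W)) ?_ ?_
      ((hWfin.finite_subsets.subset (fun T hT => hT.1)).prod (hRfin.finite_subsets.subset (fun X hX => hX.1)))
    · rintro B ⟨⟨hBE, hB7, -, -⟩, hj⟩
      have hBfin : B.Finite := hEfin.subset hBE
      have hsplit := Set.ncard_inter_add_ncard_sdiff_eq_ncard B W hBfin
      refine Set.mem_prod.2 ⟨⟨Set.inter_subset_right, hj⟩, ⟨sdiff_subset_sdiff_left hBE, ?_⟩⟩
      show (B \ W).ncard = 1
      omega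
    · rintro B₁ - B₂ - hEq
      simp only [Prod.mk.injEq] at hEq
      rw [← Set.inter_union_sdiff B₁ W, ← Set.inter_union_sdiff B₂ W, hEq.1, hEq.2]
  -- the class `j = 7`: the set lies inside `W`
  have hC7 : (C 7).ncard ≤ W.ncard.choose 7 := by
    rw [← ncard_subsets_ncard_eq W hWfin 7]
    refine Set.ncard_le_ncard ?_ (hWfin.finite_subsets.subset (fun T hT => hT.1))
    rintro B ⟨⟨hBE, hB7, -, -⟩, hj⟩
    have hBfin : B.Finite := hEfin.subset hBE
    have hBW : B ⊆ W := by
      have heq : B ∩ W = B := Set.eq_of_subset_of_ncard_le Set.inter_subset_left (by rw [hj, hB7]) hBfin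
      rw [← heq]
      exact Set.inter_subset_right
    exact ⟨hBW, hB7⟩
  calc Top.ncard ≤ (C 5 ∪ C 6 ∪ C 7).ncard :=
        Set.ncard_le_ncard hcover (((hCfin 5).union (hCfin 6)).union (hCfin 7))
    _ ≤ (C 5 ∪ C 6).ncard + (C 7).ncard := Set.ncard_union_le _ _
    _ ≤ (C 5).ncard + (C 6).ncard + (C 7).ncard := Nat.add_le_add_right (Set.ncard_union_le _ _) _
    _ ≤ _ := Nat.add_le_add (Nat.add_le_add hC5 hC6) hC7

/-- **The dependent `5`-subsets of a `10`-point set with an independent complement number `≤ 126`**: `T ↦ W ∖ T` maps them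
injectively onto the disjoint family of independent `5`-subsets with a dependent complement, inside the `C(10, 5) = 252`
five-subsets. -/
theorem ncard_dep_compl_indep_five_le (M : Matroid α) [M.Finite] {W : Set α} (hW : W ⊆ M.E) (hw : W.ncard = 10) :
    {T : Set α | T ⊆ W ∧ T.ncard = 5 ∧ M.Dep T ∧ M.Indep (W \ T)}.ncard ≤ 126 := by
  classical
  have hWfin : W.Finite := M.ground_finite.subset hW
  set F := {T : Set α | T ⊆ W ∧ T.ncard = 5 ∧ M.Dep T ∧ M.Indep (W \ T)} with hF
  set F' := {T : Set α | T ⊆ W ∧ T.ncard = 5 ∧ M.Indep T ∧ M.Dep (W \ T)} with hF'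
  have hFfin : F.Finite := hWfin.finite_subsets.subset (fun T hT => hT.1)
  have hF'fin : F'.Finite := hWfin.finite_subsets.subset (fun T hT => hT.1)
  have hinj : F.ncard ≤ F'.ncard := by
    refine Set.ncard_le_ncard_of_injOn (fun T => W \ T) ?_ ?_ hF'fin
    · rintro T ⟨hTW, hT5, hTdep, hTind⟩
      refine ⟨Set.sdiff_subset, ?_, hTind, ?_⟩
      · rw [Set.ncard_sdiff hTW (hWfin.subset hTW), hw, hT5]
      · rw [Set.sdiff_sdiff_cancel_left hTW]
        exact hTdep
    · rintro T₁ ⟨h1, -⟩ T₂ ⟨h2, -⟩ hEq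
      have := congrArg (fun S : Set α => W \ S) hEq
      simpa only [Set.sdiff_sdiff_cancel_left h1, Set.sdiff_sdiff_cancel_left h2] using this
  have hdis : Disjoint F F' := by
    rw [Set.disjoint_left]
    rintro T ⟨-, -, hdep, -⟩ ⟨-, -, hind, -⟩
    exact hdep.not_indep hind
  have hsub : F ∪ F' ⊆ {T : Set α | T ⊆ W ∧ T.ncard = 5} := by
    rintro T (⟨h1, h2, -⟩ | ⟨h1, h2, -⟩) <;> exact ⟨h1, h2⟩
  have h := Set.ncard_le_ncard hsub (hWfin.finite_subsets.subset (fun T hT => hT.1))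
  rw [ncard_subsets_ncard_eq W hWfin 5, hw, Set.ncard_union_eq hdis hFfin hF'fin] at h
  norm_num [Nat.choose] at h
  omega

end S2

end PercRepro
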